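import Summits.NavierStokesRegularity.NavierStokesRegularity.Theorems.LandauTailHomSteadyProfileExistsCalculus
import HarnessLib

/-!
# SwirlHolderTower, part 3a — pointwise calculus of the separable swirl `|x|^γ G(x₃/|x|)`
# (ROUND-15 typing request T-15.3, first half; seat nsreg-p4)

Support file for the DORMANT route `SwirlThreshold` (crux stmt-NavierStokesRegularity-2002) and for
`…Theorems.SwirlHolderTowerFunnel`, whose kernel ceiling `linearHolderLaw_ceiling` on every LINEAR
swirl Hölder law takes the classical package `FunnelSeparation` as a hypothesis.  This file and its
two sequels (`…FunnelDrift`, `…FunnelSeparation`) DISCHARGE that package.  Here: the second-order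
calculus, at a point `x ≠ 0` of `ℝ³` only (nothing is globally smooth), of the profile form
`Θ(y) = (‖y‖²)^{γ/2} · G(y₂ (‖y‖²)^{-1/2})` of `separableSwirl γ G` (`y₂ (‖y‖²)^{-1/2} = y₂/‖y‖ =
cos ϑ`), assembled from three tree tools — the radial calculus of `z ↦ g(‖z‖²)`
(`Literature.Analysis.FluidPDE.laplacian_comp_norm_sq`), the pointwise Leibniz rule
(`Literature.Analysis.PDE.LoewnerNirenberg.laplacian_smul_apply`) and the pointwise chain rule
through a scalar (`…Theorems.LandauTail.laplacian_comp_deriv_apply`):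

* `laplacian_norm_sq_rpow`: `Δ(‖·‖²)^p = 2p(2p+1)(‖x‖²)^{p-1}` (so `Δ|x|^γ = γ(γ+1)|x|^{γ-2}` and
  `Δ|x|⁻¹ = 0`); `fderiv_tau_apply`, `sum_fderiv_tau_sq` (`|∇τ|² = (‖x‖² - x₂²)/‖x‖⁴`),
  `laplacian_tau` (`Δτ = -2x₂/‖x‖³`) for `τ(y) = y₂/‖y‖`;
* `laplacian_comp_tau`: `Δ(G ∘ τ) = G''(t)(1 - t²)/‖x‖² - 2t G'(t)/‖x‖²`, `t = x₂/‖x‖`;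
* `sum_fderiv_rpow_mul_fderiv_comp_tau`: the cross term `∇|x|^γ · ∇(G ∘ τ)` vanishes (`τ` is
  `0`-homogeneous);
* `laplacian_rpow_mul_comp_tau`: **`ΔΘ(x) = |x|^{γ-2} (γ(γ+1) G(t) + (1-t²) G''(t) - 2t G'(t))`**,
  and `fderiv_rpow_mul_comp_tau_apply`:
  `DΘ(x) a = |x|^{γ-2}(γ G(t) - t G'(t)) ⟪x,a⟫ + |x|^{γ-1} G'(t) a₂`.

With the angular ODE of `FunnelODE` these give the steady swirl equation for the funnel (sequel).
WHAT THIS IS NOT: not NS regularity — classical multivariable calculus serving a ceiling on LINEAR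
(passive-scalar) methods; `FunnelExponent` (the ODE fact) and all hard cores untouched; no crux claim.
-/

namespace Summit.NavierStokesRegularity.NavierStokesRegularity.Theorems.SwirlHolderTower

open Set Filter Topology
open scoped Laplacian RealInnerProductSpace
open Literature.Analysis.FluidPDE Literature.Analysis.PDE.LoewnerNirenberg
open Summit.NavierStokesRegularity.NavierStokesRegularity.Theorems.LandauTail

noncomputable section


/-- `D[(‖·‖²)^p](x) = 2p(‖x‖²)^{p-1} ⟪x, ·⟫` at `x ≠ 0`. -/
theorem hasFDerivAt_norm_sq_rpow (p : ℝ) {x : EuclideanSpace ℝ (Fin 3)} (hx : x ≠ 0) :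
    HasFDerivAt (fun y : EuclideanSpace ℝ (Fin 3) => (‖y‖ ^ 2) ^ p)
      ((2 * (p * (‖x‖ ^ 2) ^ (p - 1))) • (innerSL ℝ x : EuclideanSpace ℝ (Fin 3) →L[ℝ] ℝ)) x := by
  have hσ : (‖x‖ ^ 2) ≠ 0 := (pow_pos (norm_pos_iff.mpr hx) 2).ne'
  exact hasFDerivAt_comp_norm_sq (g := fun s : ℝ => s ^ p) (Real.hasDerivAt_rpow_const (Or.inl hσ))

/-- `(‖·‖²)^p` is smooth at `x ≠ 0`. -/
theorem contDiffAt_norm_sq_rpow (p : ℝ) {n : WithTop ℕ∞} {x : EuclideanSpace ℝ (Fin 3)} (hx : x ≠ 0) :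
    ContDiffAt ℝ n (fun y : EuclideanSpace ℝ (Fin 3) => (‖y‖ ^ 2) ^ p) x := by
  have hσ : (‖x‖ ^ 2) ≠ 0 := (pow_pos (norm_pos_iff.mpr hx) 2).ne'
  exact ((contDiff_norm_sq ℝ (n := n)).contDiffAt).rpow_const_of_ne hσ

/-- `Δ[(‖·‖²)^p](x) = 2p(2p+1)(‖x‖²)^{p-1}` at `x ≠ 0` (dimension three). -/
theorem laplacian_norm_sq_rpow (p : ℝ) {x : EuclideanSpace ℝ (Fin 3)} (hx : x ≠ 0) :
    (Δ (fun y : EuclideanSpace ℝ (Fin 3) => (‖y‖ ^ 2) ^ p)) x =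
      2 * p * (2 * p + 1) * (‖x‖ ^ 2) ^ (p - 1) := by
  have hσ : 0 < ‖x‖ ^ 2 := pow_pos (norm_pos_iff.mpr hx) 2
  have hg : ∀ σ ∈ Ioi (0:ℝ), HasDerivAt (fun s : ℝ => s ^ p) (p * σ ^ (p - 1)) σ :=
    fun σ hσ' => Real.hasDerivAt_rpow_const (Or.inl (ne_of_gt hσ'))
  have hg₁ : HasDerivAt (fun σ : ℝ => p * σ ^ (p - 1)) (p * ((p - 1) * (‖x‖ ^ 2) ^ (p - 1 - 1)))
      (‖x‖ ^ 2) :=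
    (Real.hasDerivAt_rpow_const (Or.inl hσ.ne')).const_mul p
  rw [laplacian_comp_norm_sq isOpen_Ioi hg hσ hg₁, finrank_euclideanSpace_fin]
  have h1 : (‖x‖ ^ 2) ^ (p - 1 - 1) * ‖x‖ ^ 2 = (‖x‖ ^ 2) ^ (p - 1) := by
    rw [Real.rpow_sub_one hσ.ne' (p - 1), div_mul_cancel₀ _ hσ.ne']
  push_cast
  linear_combination (4 * p * (p - 1)) * h1

/-- `(‖x‖²)^{γ/2} = ‖x‖^γ`. -/
theorem norm_sq_rpow_half (γ : ℝ) (x : EuclideanSpace ℝ (Fin 3)) : (‖x‖ ^ 2) ^ (γ / 2) = ‖x‖ ^ γ := by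
  rw [← Real.rpow_natCast_mul (norm_nonneg x) 2 (γ / 2)]
  congr 1; push_cast; ring

/-- `(‖x‖²)^{-1/2} = ‖x‖⁻¹`. -/
theorem norm_sq_rpow_neg_half (x : EuclideanSpace ℝ (Fin 3)) : (‖x‖ ^ 2) ^ (-(1 / 2 : ℝ)) = ‖x‖⁻¹ := by
  rw [Real.rpow_neg (sq_nonneg _), ← Real.sqrt_eq_rpow, Real.sqrt_sq (norm_nonneg x)]

/-- The derivative of `τ(y) = y₂ (‖y‖²)^{-1/2} = y₂/‖y‖` at `x ≠ 0`. -/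
theorem hasFDerivAt_tau {x : EuclideanSpace ℝ (Fin 3)} (hx : x ≠ 0) :
    HasFDerivAt (fun y : EuclideanSpace ℝ (Fin 3) => y 2 * (‖y‖ ^ 2) ^ (-(1 / 2 : ℝ)))
      (x 2 • ((2 * (-(1 / 2 : ℝ) * (‖x‖ ^ 2) ^ (-(1 / 2 : ℝ) - 1))) •
          (innerSL ℝ x : EuclideanSpace ℝ (Fin 3) →L[ℝ] ℝ)) +
        (‖x‖ ^ 2) ^ (-(1 / 2 : ℝ)) • (EuclideanSpace.proj (2 : Fin 3) : EuclideanSpace ℝ (Fin 3) →L[ℝ] ℝ)) x := by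
  have h1 : HasFDerivAt (fun y : EuclideanSpace ℝ (Fin 3) => y 2)
      (EuclideanSpace.proj (2 : Fin 3) : EuclideanSpace ℝ (Fin 3) →L[ℝ] ℝ) x :=
    (EuclideanSpace.proj (2 : Fin 3) : EuclideanSpace ℝ (Fin 3) →L[ℝ] ℝ).hasFDerivAt
  exact h1.mul (hasFDerivAt_norm_sq_rpow (-(1 / 2 : ℝ)) hx)

/-- `τ` is smooth at `x ≠ 0`. -/
theorem contDiffAt_tau {n : WithTop ℕ∞} {x : EuclideanSpace ℝ (Fin 3)} (hx : x ≠ 0) :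
    ContDiffAt ℝ n (fun y : EuclideanSpace ℝ (Fin 3) => y 2 * (‖y‖ ^ 2) ^ (-(1 / 2 : ℝ))) x :=
  (EuclideanSpace.proj (2 : Fin 3) : EuclideanSpace ℝ (Fin 3) →L[ℝ] ℝ).contDiff.contDiffAt.mul
    (contDiffAt_norm_sq_rpow _ hx)

/-- `Δτ(x) = -2 x₂ / ‖x‖³` at `x ≠ 0`. -/
theorem laplacian_tau {x : EuclideanSpace ℝ (Fin 3)} (hx : x ≠ 0) :
    (Δ (fun y : EuclideanSpace ℝ (Fin 3) => y 2 * (‖y‖ ^ 2) ^ (-(1 / 2 : ℝ)))) x =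
      -2 * x 2 / ‖x‖ ^ 3 := by
  have hρ : 0 < ‖x‖ := norm_pos_iff.mpr hx
  have hσ : 0 < ‖x‖ ^ 2 := pow_pos hρ 2
  have hc : ContDiffAt ℝ 2 (fun y : EuclideanSpace ℝ (Fin 3) => y 2) x :=
    (EuclideanSpace.proj (2 : Fin 3) : EuclideanSpace ℝ (Fin 3) →L[ℝ] ℝ).contDiff.contDiffAt
  have hh : ContDiffAt ℝ 2 (fun y : EuclideanSpace ℝ (Fin 3) => (‖y‖ ^ 2) ^ (-(1 / 2 : ℝ))) x :=
    contDiffAt_norm_sq_rpow _ hx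
  -- `Δ(y ↦ y₂) = 0` (a linear coordinate; cf. `…CriticalSwirlRegularity.Negative.laplacian_coord_two`)
  have hD : fderiv ℝ (fun y : EuclideanSpace ℝ (Fin 3) => y 2) =
      fun _ => (EuclideanSpace.proj (2 : Fin 3) : EuclideanSpace ℝ (Fin 3) →L[ℝ] ℝ) := by
    funext y
    exact (EuclideanSpace.proj (2 : Fin 3) : EuclideanSpace ℝ (Fin 3) →L[ℝ] ℝ).fderiv
  have hc0 : (Δ (fun y : EuclideanSpace ℝ (Fin 3) => y 2)) x = 0 := by
    rw [laplacian_eq_sum_fderiv_fderiv_apply (by rw [hD]; exact differentiableAt_const _)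
      (EuclideanSpace.basisFun (Fin 3) ℝ)]
    simp [hD]
  have h := laplacian_smul_apply hc hh (EuclideanSpace.basisFun (Fin 3) ℝ)
  simp only [smul_eq_mul] at h
  rw [h, hc0, laplacian_norm_sq_rpow _ hx]
  have hD1 : ∀ i : Fin 3, fderiv ℝ (fun y : EuclideanSpace ℝ (Fin 3) => y 2) x
      ((EuclideanSpace.basisFun (Fin 3) ℝ) i) = if i = 2 then 1 else 0 := by
    intro i
    have hproj : fderiv ℝ (fun y : EuclideanSpace ℝ (Fin 3) => y 2) x =
        (EuclideanSpace.proj (2 : Fin 3) : EuclideanSpace ℝ (Fin 3) →L[ℝ] ℝ) :=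
      (EuclideanSpace.proj (2 : Fin 3) : EuclideanSpace ℝ (Fin 3) →L[ℝ] ℝ).fderiv
    rw [hproj]
    fin_cases i <;> simp
  have hD2 : ∀ i : Fin 3, fderiv ℝ (fun y : EuclideanSpace ℝ (Fin 3) => (‖y‖ ^ 2) ^ (-(1 / 2 : ℝ))) x
      ((EuclideanSpace.basisFun (Fin 3) ℝ) i) =
        2 * (-(1 / 2 : ℝ) * (‖x‖ ^ 2) ^ (-(1 / 2 : ℝ) - 1)) * x i := by
    intro i
    rw [(hasFDerivAt_norm_sq_rpow (-(1 / 2 : ℝ)) hx).fderiv]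
    simp [EuclideanSpace.inner_single_right]
  simp only [Fin.sum_univ_three, hD1, hD2]
  simp only [Fin.isValue, Fin.reduceEq, ↓reduceIte]
  rw [Real.rpow_sub_one hσ.ne', norm_sq_rpow_neg_half]
  field_simp
  ring


/-- `Σᵢ (∂ᵢτ)² = |∇τ|² = (‖x‖² - x₂²)/‖x‖⁴` at `x ≠ 0`. -/
theorem sum_fderiv_tau_sq {x : EuclideanSpace ℝ (Fin 3)} (hx : x ≠ 0) :
    ∑ i, (fderiv ℝ (fun y : EuclideanSpace ℝ (Fin 3) => y 2 * (‖y‖ ^ 2) ^ (-(1 / 2 : ℝ))) x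
      ((EuclideanSpace.basisFun (Fin 3) ℝ) i)) ^ 2 = (‖x‖ ^ 2 - x 2 ^ 2) / ‖x‖ ^ 4 := by
  have hρ : 0 < ‖x‖ := norm_pos_iff.mpr hx
  have hσ : 0 < ‖x‖ ^ 2 := pow_pos hρ 2
  rw [(hasFDerivAt_tau hx).fderiv]
  simp only [Fin.sum_univ_three, EuclideanSpace.basisFun_apply, add_apply,
    FunLike.coe_smul, Pi.smul_apply, innerSL_apply_apply, EuclideanSpace.inner_single_right,
    conj_trivial, PiLp.proj_apply, PiLp.single_apply, smul_eq_mul]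
  simp only [Fin.isValue, Fin.reduceEq, ↓reduceIte, mul_one, mul_zero, add_zero]
  rw [Real.rpow_sub_one hσ.ne', norm_sq_rpow_neg_half]
  have h3 := (EuclideanSpace.real_norm_sq_eq x)
  rw [Fin.sum_univ_three] at h3
  field_simp
  linear_combination (-(x 2) ^ 2) * h3


/-- `τ(x) = x₂/‖x‖`. -/
theorem tau_eq (x : EuclideanSpace ℝ (Fin 3)) : x 2 * (‖x‖ ^ 2) ^ (-(1 / 2 : ℝ)) = x 2 / ‖x‖ := by
  rw [norm_sq_rpow_neg_half, div_eq_mul_inv]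

/-- `∂ₐτ(x) = a₂/‖x‖ - x₂⟪x,a⟫/‖x‖³` at `x ≠ 0`. -/
theorem fderiv_tau_apply {x : EuclideanSpace ℝ (Fin 3)} (hx : x ≠ 0) (a : EuclideanSpace ℝ (Fin 3)) :
    fderiv ℝ (fun y : EuclideanSpace ℝ (Fin 3) => y 2 * (‖y‖ ^ 2) ^ (-(1 / 2 : ℝ))) x a =
      a 2 / ‖x‖ - x 2 * ⟪x, a⟫ / ‖x‖ ^ 3 := by
  have hρ : 0 < ‖x‖ := norm_pos_iff.mpr hx
  have hσ : 0 < ‖x‖ ^ 2 := pow_pos hρ 2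
  rw [(hasFDerivAt_tau hx).fderiv]
  simp only [add_apply, FunLike.coe_smul, Pi.smul_apply, innerSL_apply_apply, PiLp.proj_apply,
    smul_eq_mul]
  rw [Real.rpow_sub_one hσ.ne', norm_sq_rpow_neg_half]
  field_simp
  ring

variable {G : ℝ → ℝ}

/-- Chain rule: `D(G ∘ τ)(x) = G'(x₂/‖x‖) Dτ(x)` at `x ≠ 0`. -/
theorem hasFDerivAt_comp_tau (hG : ContDiff ℝ 2 G) {x : EuclideanSpace ℝ (Fin 3)} (hx : x ≠ 0) :
    HasFDerivAt (fun y : EuclideanSpace ℝ (Fin 3) => G (y 2 * (‖y‖ ^ 2) ^ (-(1 / 2 : ℝ))))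
      (deriv G (x 2 / ‖x‖) •
        fderiv ℝ (fun y : EuclideanSpace ℝ (Fin 3) => y 2 * (‖y‖ ^ 2) ^ (-(1 / 2 : ℝ))) x) x := by
  have hG1 : HasDerivAt G (deriv G (x 2 * (‖x‖ ^ 2) ^ (-(1 / 2 : ℝ)))) (x 2 * (‖x‖ ^ 2) ^ (-(1 / 2 : ℝ))) :=
    ((hG.differentiable (by norm_num)) _).hasDerivAt
  have hτ : HasFDerivAt (fun y : EuclideanSpace ℝ (Fin 3) => y 2 * (‖y‖ ^ 2) ^ (-(1 / 2 : ℝ)))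
      (fderiv ℝ (fun y : EuclideanSpace ℝ (Fin 3) => y 2 * (‖y‖ ^ 2) ^ (-(1 / 2 : ℝ))) x) x :=
    (hasFDerivAt_tau hx).differentiableAt.hasFDerivAt
  have h := hG1.comp_hasFDerivAt x hτ
  rw [tau_eq] at h
  exact h

/-- `∂ₐ(G ∘ τ)(x) = G'(x₂/‖x‖) (a₂/‖x‖ - x₂⟪x,a⟫/‖x‖³)` at `x ≠ 0`. -/
theorem fderiv_comp_tau_apply (hG : ContDiff ℝ 2 G) {x : EuclideanSpace ℝ (Fin 3)} (hx : x ≠ 0)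
    (a : EuclideanSpace ℝ (Fin 3)) :
    fderiv ℝ (fun y : EuclideanSpace ℝ (Fin 3) => G (y 2 * (‖y‖ ^ 2) ^ (-(1 / 2 : ℝ)))) x a =
      deriv G (x 2 / ‖x‖) * (a 2 / ‖x‖ - x 2 * ⟪x, a⟫ / ‖x‖ ^ 3) := by
  rw [(hasFDerivAt_comp_tau hG hx).fderiv, FunLike.coe_smul, Pi.smul_apply,
    fderiv_tau_apply hx, smul_eq_mul]

/-- `G ∘ τ` is `C²` at `x ≠ 0`. -/
theorem contDiffAt_comp_tau (hG : ContDiff ℝ 2 G) {x : EuclideanSpace ℝ (Fin 3)} (hx : x ≠ 0) :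
    ContDiffAt ℝ 2 (fun y : EuclideanSpace ℝ (Fin 3) => G (y 2 * (‖y‖ ^ 2) ^ (-(1 / 2 : ℝ)))) x :=
  hG.contDiffAt.comp x (contDiffAt_tau hx)

/-- **`Δ(G ∘ τ)(x) = G''(t)(‖x‖² - x₂²)/‖x‖⁴ - 2 G'(t) x₂/‖x‖³`**, `t = x₂/‖x‖`, at `x ≠ 0`. -/
theorem laplacian_comp_tau (hG : ContDiff ℝ 2 G) {x : EuclideanSpace ℝ (Fin 3)} (hx : x ≠ 0) :
    (Δ (fun y : EuclideanSpace ℝ (Fin 3) => G (y 2 * (‖y‖ ^ 2) ^ (-(1 / 2 : ℝ))))) x =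
      deriv (deriv G) (x 2 / ‖x‖) * ((‖x‖ ^ 2 - x 2 ^ 2) / ‖x‖ ^ 4) +
        deriv G (x 2 / ‖x‖) * (-2 * x 2 / ‖x‖ ^ 3) := by
  have hG1 : ∀ σ ∈ (univ : Set ℝ), HasDerivAt G (deriv G σ) σ := fun σ _ =>
    ((hG.differentiable (by norm_num)) σ).hasDerivAt
  have hG2 : HasDerivAt (deriv G) (deriv (deriv G) (x 2 * (‖x‖ ^ 2) ^ (-(1 / 2 : ℝ))))
      (x 2 * (‖x‖ ^ 2) ^ (-(1 / 2 : ℝ))) :=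
    (hG.differentiable_deriv_two _).hasDerivAt
  rw [laplacian_comp_deriv_apply (EuclideanSpace.basisFun (Fin 3) ℝ) (contDiffAt_tau hx) isOpen_univ
    hG1 (mem_univ _) hG2, sum_fderiv_tau_sq hx, laplacian_tau hx, tau_eq]

/-- The cross term `Σᵢ ∂ᵢ(‖·‖²)^{γ/2} ∂ᵢ(G ∘ τ)` VANISHES (`x·∇τ = 0`: `τ` is `0`-homogeneous). -/
theorem sum_fderiv_rpow_mul_fderiv_comp_tau (hG : ContDiff ℝ 2 G) (γ : ℝ)
    {x : EuclideanSpace ℝ (Fin 3)} (hx : x ≠ 0) :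
    ∑ i, fderiv ℝ (fun y : EuclideanSpace ℝ (Fin 3) => (‖y‖ ^ 2) ^ (γ / 2)) x
        ((EuclideanSpace.basisFun (Fin 3) ℝ) i) *
      fderiv ℝ (fun y : EuclideanSpace ℝ (Fin 3) => G (y 2 * (‖y‖ ^ 2) ^ (-(1 / 2 : ℝ)))) x
        ((EuclideanSpace.basisFun (Fin 3) ℝ) i) = 0 := by
  have hρ : 0 < ‖x‖ := norm_pos_iff.mpr hx
  simp only [fderiv_comp_tau_apply hG hx, (hasFDerivAt_norm_sq_rpow (γ / 2) hx).fderiv,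
    Fin.sum_univ_three, EuclideanSpace.basisFun_apply, FunLike.coe_smul, Pi.smul_apply,
    innerSL_apply_apply, EuclideanSpace.inner_single_right, conj_trivial, PiLp.single_apply,
    smul_eq_mul]
  simp only [Fin.isValue, Fin.reduceEq, ↓reduceIte]
  have h3 := (EuclideanSpace.real_norm_sq_eq x)
  rw [Fin.sum_univ_three] at h3
  field_simp
  linear_combination (γ * (‖x‖ ^ 2) ^ ((γ - 2) / 2) * deriv G (x 2 / ‖x‖) * x 2) * h3

/-- **LAPLACIAN OF THE SEPARABLE SWIRL (profile form)**: for `Θ(y) = (‖y‖²)^{γ/2} G(τ y)` and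
`x ≠ 0`, with `t = x₂/‖x‖`,
`ΔΘ(x) = ‖x‖^γ/‖x‖² · (γ(γ+1) G(t) + (1 - t²) G''(t) - 2t G'(t))`. -/
theorem laplacian_rpow_mul_comp_tau (hG : ContDiff ℝ 2 G) (γ : ℝ)
    {x : EuclideanSpace ℝ (Fin 3)} (hx : x ≠ 0) :
    (Δ (fun y : EuclideanSpace ℝ (Fin 3) =>
      (‖y‖ ^ 2) ^ (γ / 2) * G (y 2 * (‖y‖ ^ 2) ^ (-(1 / 2 : ℝ))))) x =
      ‖x‖ ^ γ / ‖x‖ ^ 2 *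
        (γ * (γ + 1) * G (x 2 / ‖x‖) + (1 - (x 2 / ‖x‖) ^ 2) * deriv (deriv G) (x 2 / ‖x‖)
          - 2 * (x 2 / ‖x‖) * deriv G (x 2 / ‖x‖)) := by
  have hρ : 0 < ‖x‖ := norm_pos_iff.mpr hx
  have hσ : 0 < ‖x‖ ^ 2 := pow_pos hρ 2
  have hf : ContDiffAt ℝ 2 (fun y : EuclideanSpace ℝ (Fin 3) => (‖y‖ ^ 2) ^ (γ / 2)) x :=
    contDiffAt_norm_sq_rpow _ hx
  have h := laplacian_smul_apply hf (contDiffAt_comp_tau hG hx) (EuclideanSpace.basisFun (Fin 3) ℝ)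
  simp only [smul_eq_mul] at h
  rw [h, sum_fderiv_rpow_mul_fderiv_comp_tau hG γ hx, laplacian_norm_sq_rpow _ hx,
    laplacian_comp_tau hG hx, tau_eq, Real.rpow_sub_one hσ.ne', norm_sq_rpow_half]
  field_simp
  ring


/-- `Θ(y) = (‖y‖²)^{γ/2} G(τ y)` is `C²` at `x ≠ 0`. -/
theorem contDiffAt_rpow_mul_comp_tau (hG : ContDiff ℝ 2 G) (γ : ℝ)
    {x : EuclideanSpace ℝ (Fin 3)} (hx : x ≠ 0) :
    ContDiffAt ℝ 2 (fun y : EuclideanSpace ℝ (Fin 3) =>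
      (‖y‖ ^ 2) ^ (γ / 2) * G (y 2 * (‖y‖ ^ 2) ^ (-(1 / 2 : ℝ)))) x :=
  (contDiffAt_norm_sq_rpow _ hx).mul (contDiffAt_comp_tau hG hx)

/-- **GRADIENT OF THE SEPARABLE SWIRL (profile form)**: for `x ≠ 0`, `t = x₂/‖x‖`,
`DΘ(x) a = ‖x‖^γ/‖x‖² (γ G(t) - t G'(t)) ⟪x, a⟫ + ‖x‖^γ/‖x‖ G'(t) a₂`. -/
theorem fderiv_rpow_mul_comp_tau_apply (hG : ContDiff ℝ 2 G) (γ : ℝ)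
    {x : EuclideanSpace ℝ (Fin 3)} (hx : x ≠ 0) (a : EuclideanSpace ℝ (Fin 3)) :
    fderiv ℝ (fun y : EuclideanSpace ℝ (Fin 3) =>
        (‖y‖ ^ 2) ^ (γ / 2) * G (y 2 * (‖y‖ ^ 2) ^ (-(1 / 2 : ℝ)))) x a =
      ‖x‖ ^ γ / ‖x‖ ^ 2 * (γ * G (x 2 / ‖x‖) - x 2 / ‖x‖ * deriv G (x 2 / ‖x‖)) * ⟪x, a⟫ +
        ‖x‖ ^ γ / ‖x‖ * deriv G (x 2 / ‖x‖) * a 2 := by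
  have hρ : 0 < ‖x‖ := norm_pos_iff.mpr hx
  have hσ : 0 < ‖x‖ ^ 2 := pow_pos hρ 2
  rw [((hasFDerivAt_norm_sq_rpow (γ / 2) hx).fun_mul (hasFDerivAt_comp_tau hG hx)).fderiv]
  simp only [add_apply, FunLike.coe_smul, Pi.smul_apply, innerSL_apply_apply, smul_eq_mul,
    fderiv_tau_apply hx]
  rw [tau_eq, Real.rpow_sub_one hσ.ne', norm_sq_rpow_half]
  field_simp
  ring

end

end Summit.NavierStokesRegularity.NavierStokesRegularity.Theorems.SwirlHolderTower
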